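import Literature.MathematicalPhysics.QuantumFieldTheory.Balaban1983to89.B7SectEFLinearisationRec
import Literature.MathematicalPhysics.QuantumFieldTheory.Balaban1983to89.B7Eq99ConcreteRec
import Literature.MathematicalPhysics.QuantumFieldTheory.Balaban1983to89.B8Eq1112Quotient

/-!
# `Balaban1983to89.B8Eq1112QuotientRec` — RECORD TWIN of `B8Eq1112Quotient` §1–§3 ([Balaban1985RegularSpaces] (1.112) p. 95: the tacit
# INVERSE-CLOSURE of the classes `Λ_k(U₀, α₃)` of [3] — `\overline{R₀(u⁻¹)}ʲ = (\overline{R₀u}ʲ)⁻¹`, `u⁻¹ ∈ Λ_k(U₀, α₃)`) for the SYMMETRISED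
# CENTRED block averaging (0.4) of [Balaban1987RG1]

statement-level skeleton of published theorems with citation tags; proofs where landed; nothing here is a claim about the Yang–Mills mass gap

T. Bałaban, *Spaces of regular gauge field configurations on a lattice and gauge fixing conditions*, Commun. Math. Phys. **99** (1985) 75–102
`[Balaban1985RegularSpaces]` ("[6]"): (1.112) p. 95 («u′ = u₂u₁⁻¹ satisfies the regularity conditions (1.73), (1.74) … This follows from Proposition 8 of [3]»);
T. Bałaban, *Averaging operations for lattice gauge theories*, Commun. Math. Phys. **98** (1985) 17–51 `[Balaban1985Averaging]` ("[3]"): (56)–(57) p. 27,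
(78)–(80) p. 30, (166)–(167) p. 44 and the paragraph after (167), (22)–(23) p. 21; T. Bałaban, *Renormalization group approach to lattice gauge field
theories. I*, Commun. Math. Phys. **109** (1987) 249–301 `[Balaban1987RG1]` ("[I]"): (0.3)–(0.4) pp. 252–253, pp. 253–254.  STATUS: published, refereed.

CITATION HEADER (lean-in-tree rule).  Cell `pub-ymgap`, base `pub-ymgap-dag-n05-c` g26 — N05-REC stage 2 (director-ym №254∕№255), item R5, LEAD PEN dag-n05-e
g35 (brief `N05-REC-LEAD.md` 3bc4fb1e3b3a61aa; inventory `N05-REC-INVENTORY.md` e50db04501ab292d §R5 row `B8Eq1112Quotient`: A `uavg_inv inLambda_inv` · C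
`R0avg_inv R0fun_inv` · B `savg_inv Sexp_inv`).  WHAT IS REPRODUCED = the engine module ✓`B8Eq1112Quotient` (unit `lit-balaban-p05`) §1–§3 under the cell's
TOKEN RULE: (T1) `avgIter ↦ avgIterZ`, (T2) block points `y + boxVec L r ↦ y + offZ L r` (centred block), [3] (78)–(80) `Sexp ∕ savg ∕ R0avg ∕ uavg ↦
SexpZ ∕ savgZ ∕ R0avgZ ∕ uavgZ` (`B7SectCDGaugeAveragesRec`, R0b-1), (166)–(167) `Cond167 ∕ InLambda ↦ Cond167Z ∕ InLambdaZ` (`B7SectEFLinearisationRec`, R0b-2);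
`R0fun_inv` is structure-free and REUSED BY NAME; + the twin `uavgZ_mem_unitaryUnits` of `B7Prop8PrintedConstants.uavg_mem_unitaryUnits` ([3] p. 44 «the
logarithm of the expression in (167) … is small» ⇒ the averages of a unitary `u` are unitary), which `inLambdaZ_inv` consumes.  Proofs = the engine proofs
line by line.  Kind «kernel-checked proof», theorems only: no `def`, no `instance`, no `notation`, no existing module modified.
`--supports stmt-QuantumFields-20541` (K0⁷-keyed, COUNT-NEUTRAL).

## WHAT IS CERTIFIED HERE (kernel; axioms `propext` ∕ `Classical.choice` ∕ `Quot.sound`)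
* §1 `SexpZ_inv`, `savgZ_inv`, `R0avgZ_inv` — the centred site average (78) of the inverse is the inverse of the average (logarithms within `½` of `1`).
* §2 `uavgZ_inv` — `\overline{R₀(u⁻¹)}ʲ = (\overline{R₀u}ʲ)⁻¹`, `j ≤ k`, under (167) with `βL^kη < ½`.
* §3 `uavgZ_mem_unitaryUnits` (twin of [3] Prop. 8's unitarity remark, `B7Prop8PrintedConstants.uavg_mem_unitaryUnits`), `inLambdaZ_inv` — `Λ_k(U₀, α₃)` (record
  structure) is closed under `u ↦ u⁻¹` for unitary data, same `α₃`.

HONEST SCOPE: algebra of the exp-mean-log average + the skew-adjointness of small logarithms of unitaries; NO inequality of [3]∕[6]∕[I] beyond that — the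
engine's §4 (`eq1112_quotient`, `eq173_quotient`, `eq1112_quotient_of52` over [3] Proposition 8 (173) and Proposition 2) is NOT twinned here (road item R1's
Prop-8∕Prop-2 twins first; APPEND-ONLY v1.1 then).  `HThm4Rec` UNDISCHARGED; caveat (C-S3-1) stands; N05 [B8] DISCHARGED OF RECORD untouched; COUNT 7∕28
(7∕27 excl. NODE O) · K 1∕4 UNMOVED; one finite `𝕋⁴` programme at fixed `ε`, Bałaban AS PRINTED; nothing continuum ∕ ℝ⁴ ∕ OS ∕ mass-gap ∕ Clay.  No `sorry`.

RELATED, NOT DUPLICATED: `B8Eq1112Quotient` (engine edition; `R0fun_inv` reused), `B7SectCDGaugeAveragesRec` ∕ `B7SectEFLinearisationRec` (the definitions),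
`B7Eq99ConcreteRec` (dag-n05-e R1e: `SexpZ_apply ∕ savgZ_apply ∕ val_R0avgZ`, reused by name),
`B7Prop8PrintedConstants` (engine `uavg_mem_unitaryUnits`), `B9Eq3114Proof.mlog_units_inv` (reused).

[cite: Balaban1985RegularSpaces, (1.112) p.95; Balaban1985Averaging, (56)–(57) p.27, (78)–(80) p.30, (166)–(167) p.44, (22)–(23) p.21; Balaban1987RG1, (0.3)–(0.4) pp.252–253]
-/

noncomputable section

open NormedSpace Finset

namespace Literature.MathematicalPhysics.QuantumFieldTheory.Balaban1983to89.B8Eq1112QuotientRec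

open B7Prop1Explicit MatrixLog B7Prop2Explicit B7Eq92Concrete B7Eq99Concrete B7Eq170Flat
open B9Eq3114Proof (mlog_units_inv)
open B8Eq1112Quotient (R0fun_inv)
open B7Prop8PrintedConstants (Rc_mem_unitaryUnits)
open BlockAveragingZd (offZ avgIterZ)
open B7SectCDGaugeAveragesRec (SexpZ savgZ R0avgZ uavgZ uavgZ_zero uavgZ_succ)
open B7Eq99ConcreteRec (SexpZ_apply savgZ_apply val_R0avgZ)
open B7SectEFLinearisationRec (Cond166Z Cond167Z InLambdaZ)

export B7Prop1Explicit (Site)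

variable {d : ℕ}

/-! ## §1 The centred twisted site average (78) commutes with inversion -/

section General

variable {𝔸 : Type*} [NormedRing 𝔸] [NormedAlgebra ℂ 𝔸] [CompleteSpace 𝔸]

/-- The exponent of the centred (78) for the inverse function: `S_{g⁻¹}(y) = R(g(y))[−S_g(y)]` (twin of `Sexp_inv`; logarithms within `½` of `1`,
`B9Eq3114Proof.mlog_units_inv`). [cite: Balaban1985Averaging, (78) p.30, (21) p.21] -/
theorem SexpZ_inv (L : ℕ) {g : Site d → 𝔸ˣ} {y : Site d}
    (hW : ∀ r : Fin d → Fin L, ‖((((g y)⁻¹ * g (y + offZ L r) : 𝔸ˣ)) : 𝔸) - 1‖ < 1 / 2) :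
    SexpZ L g⁻¹ y = cj (g y) (-SexpZ L g y) := by
  rw [SexpZ_apply, SexpZ_apply, cj_neg, cj_sum, ← sum_neg_distrib]
  refine sum_congr rfl fun r _ => ?_
  have hgrp : (g⁻¹ y)⁻¹ * g⁻¹ (y + offZ L r) = Rc (g y) ((g y)⁻¹ * g (y + offZ L r))⁻¹ := by
    simp only [Pi.inv_apply, Rc_apply]; group
  rw [hgrp, val_Rc_eq_cj, mlog_cj, mlog_units_inv (hW r), cj_smul, cj_neg, smul_neg]

/-- **The centred site average (78) of the inverse is the inverse of the average** (twin of `savg_inv`): `{g⁻¹(x)}_{x∈B(y)} = ({g(x)}_{x∈B(y)})⁻¹`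
whenever `‖g(y)⁻¹g(x) − 1‖ < ½` on the block. [cite: Balaban1985Averaging, (78) p.30] -/
theorem savgZ_inv (L : ℕ) {g : Site d → 𝔸ˣ} {y : Site d}
    (hW : ∀ r : Fin d → Fin L, ‖((((g y)⁻¹ * g (y + offZ L r) : 𝔸ˣ)) : 𝔸) - 1‖ < 1 / 2) :
    savgZ L g⁻¹ y = (savgZ L g y)⁻¹ := by
  rw [savgZ_apply, savgZ_apply, SexpZ_inv L hW, Pi.inv_apply, cj_apply, expUnit_conj, mul_inv_rev, val_inv_expUnit,
    Rc_apply]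
  group

/-- **The centred twisted site average (78) of the inverse is the inverse of the average** (twin of `R0avg_inv`): `(R̄₀v⁻¹)(y) = ((R̄₀v)(y))⁻¹`
whenever the (167)-quantities `v(y)⁻¹(R_{0,y}v)(x)` lie within `½` of `1` on the block. [cite: Balaban1985Averaging, (78) p.30, (167) p.44] -/
theorem R0avgZ_inv (L : ℕ) (V₀ : Site d → Fin d → 𝔸ˣ) {v : Site d → 𝔸ˣ} {y : Site d}
    (hW : ∀ r : Fin d → Fin L, ‖((((v y)⁻¹ * R0fun V₀ y v (y + offZ L r) : 𝔸ˣ)) : 𝔸) - 1‖ < 1 / 2) :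
    R0avgZ L V₀ v⁻¹ y = (R0avgZ L V₀ v y)⁻¹ := by
  rw [R0avgZ, R0avgZ, R0fun_inv]
  refine savgZ_inv L (g := R0fun V₀ y v) fun r => ?_
  rw [R0fun_self]
  exact hW r

/-! ## §2 The `k`-th order centred averages (79)–(80) commute with inversion -/

variable {L : ℕ} {U₀ : Site d → Fin d → 𝔸ˣ} {u : Site d → 𝔸ˣ} {k : ℕ} {β η : ℝ}

/-- **`\overline{R₀(u⁻¹)}ʲ = (\overline{R₀u}ʲ)⁻¹`, `j ≤ k`, record structure** (twin of `uavg_inv`), for `u` satisfying (167) with constant `β`, `βL^kη < ½`.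
[cite: Balaban1985Averaging, (79)–(80) p.30, (167) p.44] -/
theorem uavgZ_inv (h167 : Cond167Z L U₀ u k β η) (hL : 1 ≤ L) (hη : 0 ≤ η) (hβ : 0 ≤ β)
    (hs : β * (L : ℝ) ^ k * η < 1 / 2) : ∀ j ≤ k, uavgZ L U₀ u⁻¹ j = (uavgZ L U₀ u j)⁻¹ := by
  have hLr : (1 : ℝ) ≤ L := by exact_mod_cast hL
  intro j
  induction j with
  | zero => intro _; rfl
  | succ j ih =>
    intro hjk
    have hjlt : j < k := Nat.lt_of_succ_le hjk
    funext z
    rw [uavgZ_succ, ih hjlt.le, Pi.inv_apply, uavgZ_succ]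
    refine R0avgZ_inv L (avgIterZ L U₀ j) fun r => ?_
    rw [R0fun_add]
    calc ‖((((uavgZ L U₀ u j ((L : ℤ) • z))⁻¹ *
          Rc (hol (avgIterZ L U₀ j) ((L : ℤ) • z) (treeWord (offZ L r)))
            (uavgZ L U₀ u j ((L : ℤ) • z + offZ L r)) : 𝔸ˣ)) : 𝔸) - 1‖
        ≤ β * (L : ℝ) ^ (j + 1) * η := h167 j hjlt z r
      _ ≤ β * (L : ℝ) ^ k * η :=
        mul_le_mul_of_nonneg_right (mul_le_mul_of_nonneg_left (pow_le_pow_right₀ hLr hjk) hβ) hη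
      _ < 1 / 2 := hs

end General

/-! ## §3 `Λ_k(U₀, α₃)` (record structure) is closed under inversion (unitary data, same `α₃`) -/

section Unitary

variable {𝔸 : Type*} [CStarAlgebra 𝔸]

/-- `|A⁻¹ − 1| = |A − 1|` for unitary `A` (`A⁻¹ = A⋆`). [folklore] -/
private theorem norm_inv_sub_one_of_unitary {A : 𝔸ˣ} (hA : A ∈ unitaryUnits 𝔸) :
    ‖((A⁻¹ : 𝔸ˣ) : 𝔸) - 1‖ = ‖(A : 𝔸) - 1‖ := by
  have hstar := (mem_unitaryUnits).1 ((unitaryUnits 𝔸).inv_mem hA)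
  have h : ((A⁻¹ : 𝔸ˣ) : 𝔸) - 1 = ((A⁻¹ : 𝔸ˣ) : 𝔸) * (1 - (A : 𝔸)) := by
    rw [mul_sub, mul_one, Units.inv_mul]
  rw [h, CStarRing.norm_mem_unitary_mul _ hstar, norm_sub_rev]

/-- `|AB⁻¹ − 1| = |A⁻¹B − 1|` for unitaries `A, B` (both equal `|A − B|`). [folklore] -/
private theorem norm_mul_inv_sub_one_eq {A B : 𝔸ˣ} (hA : A ∈ unitaryUnits 𝔸) (hB : B ∈ unitaryUnits 𝔸) :
    ‖(((A * B⁻¹ : 𝔸ˣ)) : 𝔸) - 1‖ = ‖(((A⁻¹ * B : 𝔸ˣ)) : 𝔸) - 1‖ := by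
  have h1 : (((A * B⁻¹ : 𝔸ˣ)) : 𝔸) - 1 = ((A : 𝔸) - (B : 𝔸)) * ((B⁻¹ : 𝔸ˣ) : 𝔸) := by
    rw [Units.val_mul, sub_mul, Units.mul_inv]
  have h2 : (((A⁻¹ * B : 𝔸ˣ)) : 𝔸) - 1 = ((A⁻¹ : 𝔸ˣ) : 𝔸) * ((B : 𝔸) - (A : 𝔸)) := by
    rw [Units.val_mul, mul_sub, Units.inv_mul]
  rw [h1, h2, CStarRing.norm_mul_mem_unitary _ ((mem_unitaryUnits).1 ((unitaryUnits 𝔸).inv_mem hB)),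
    CStarRing.norm_mem_unitary_mul _ ((mem_unitaryUnits).1 ((unitaryUnits 𝔸).inv_mem hA)), norm_sub_rev]

variable {L : ℕ} {U₀ : Site d → Fin d → 𝔸ˣ} {u : Site d → 𝔸ˣ} {k : ℕ} {α₃ β η : ℝ}

/-- **For `u ∈ Λ_k(U₀, α₃)` the centred averages `\overline{R₀u}ʲ(x_j)` are unitary, `j ≤ k`** (twin of `B7Prop8PrintedConstants.uavg_mem_unitaryUnits`; print p. 44
«all operations needed to define R̄₀uᵏ are done always in a case where proper expressions are small … we have to calculate a logarithm of the expression in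
(167) and this expression is small»): for a unitary-valued `u` satisfying (167) with `βL^kη ≤ 1/4` at a background whose record averages `Ū₀ʲ = avgIterZ L U₀ j`,
`j < k`, are unitary-valued — by (78)∕(80) (`val_R0avgZ`, `uavgZ_succ`) every step is `ūʲ(Lx)·exp[Σ L⁻ᵈ log(…)]` with skew-adjoint logarithms of the unitary
(167)-quantities (`B7Prop2Explicit.star_mlog_eq_neg`). [cite: Balaban1985Averaging, (166)–(167) p.44, (78)–(80) p.30, (22)–(23) p.21] -/
theorem uavgZ_mem_unitaryUnits (hV : ∀ j < k, ∀ (x : Site d) (κ : Fin d), avgIterZ L U₀ j x κ ∈ unitaryUnits 𝔸)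
    (hu : ∀ x, u x ∈ unitaryUnits 𝔸) (h167 : Cond167Z L U₀ u k β η)
    (hL : 1 ≤ L) (hη : 0 ≤ η) (hβ : 0 ≤ β) (hs : β * (L : ℝ) ^ k * η ≤ 1 / 4) :
    ∀ j ≤ k, ∀ z : Site d, uavgZ L U₀ u j z ∈ unitaryUnits 𝔸 := by
  have hLr : (1 : ℝ) ≤ L := by exact_mod_cast hL
  intro j
  induction j with
  | zero =>
    intro _ z
    rw [uavgZ_zero]
    exact hu z
  | succ j ih =>
    intro hjk z
    have hjlt : j < k := Nat.lt_of_succ_le hjk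
    have ihj := ih hjlt.le
    set y : Site d := (L : ℤ) • z with hy
    rw [mem_unitaryUnits, uavgZ_succ, val_R0avgZ]
    refine Submonoid.mul_mem _ ((mem_unitaryUnits).1 (ihj y)) ?_
    have hS : (∑ r : Fin d → Fin L, (((L : ℝ) ^ d)⁻¹) •
        mlog ((((uavgZ L U₀ u j y)⁻¹ *
          Rc (hol (avgIterZ L U₀ j) y (treeWord (offZ L r))) (uavgZ L U₀ u j (y + offZ L r)) : 𝔸ˣ)) : 𝔸)) ∈
        skewAdjoint 𝔸 := by
      refine sum_mem fun r _ => skewAdjoint.smul_mem _ ?_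
      rw [skewAdjoint.mem_iff]
      refine star_mlog_eq_neg ?_ ?_
      · exact (mem_unitaryUnits).1 ((unitaryUnits 𝔸).mul_mem ((unitaryUnits 𝔸).inv_mem (ihj y))
          (Rc_mem_unitaryUnits (hol_mem_of (hV j hjlt) _ _) (ihj _)))
      · calc ‖((((uavgZ L U₀ u j y)⁻¹ *
              Rc (hol (avgIterZ L U₀ j) y (treeWord (offZ L r))) (uavgZ L U₀ u j (y + offZ L r)) : 𝔸ˣ)) : 𝔸) - 1‖
            ≤ β * (L : ℝ) ^ (j + 1) * η := h167 j hjlt z r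
          _ ≤ β * (L : ℝ) ^ k * η :=
            mul_le_mul_of_nonneg_right (mul_le_mul_of_nonneg_left (pow_le_pow_right₀ hLr hjk) hβ) hη
          _ ≤ 1 / 4 := hs
    letI : NormedAlgebra ℚ 𝔸 := NormedAlgebra.restrictScalars ℚ ℂ 𝔸
    exact NormedSpace.exp_mem_unitary_of_mem_skewAdjoint hS

/-- **`Λ_k(U₀, α₃)` (record structure) is closed under `u ↦ u⁻¹`** (twin of `inLambda_inv`; tacit in [6] p. 95 ∕ [3] p. 45): for a unitary-valued
`u ∈ Λ_k(U₀, α₃)` at a background with unitary-valued `Ū₀ʲ` (`j < k`), `L ≥ 1`, `0 ≤ η`, `0 ≤ α₃`, `α₃L^kη ≤ 1/4`, also `u⁻¹ ∈ Λ_k(U₀, α₃)` with the SAME `α₃`.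
[cite: Balaban1985RegularSpaces, (1.112) p.95; Balaban1985Averaging, (166)–(167) p.44] -/
theorem inLambdaZ_inv (hV : ∀ j < k, ∀ (x : Site d) (κ : Fin d), avgIterZ L U₀ j x κ ∈ unitaryUnits 𝔸)
    (hu : ∀ x, u x ∈ unitaryUnits 𝔸) (h : InLambdaZ L U₀ u k α₃ η)
    (hL : 1 ≤ L) (hη : 0 ≤ η) (hα0 : 0 ≤ α₃) (hs : α₃ * (L : ℝ) ^ k * η ≤ 1 / 4) :
    InLambdaZ L U₀ u⁻¹ k α₃ η := by
  have hinv := uavgZ_inv h.2 hL hη hα0 (hs.trans_lt (by norm_num))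
  have hun := uavgZ_mem_unitaryUnits hV hu h.2 hL hη hα0 hs
  refine ⟨fun j hj z => ?_, fun j hj z r => ?_⟩
  · rw [hinv j hj, Pi.inv_apply, norm_inv_sub_one_of_unitary (hun j hj z)]
    exact h.1 j hj z
  · rw [hinv j hj.le]
    simp only [Pi.inv_apply, inv_inv, map_inv]
    rw [norm_mul_inv_sub_one_eq (hun j hj.le _) (Rc_mem_unitaryUnits (hol_mem_of (hV j hj) _ _) (hun j hj.le _))]
    exact h.2 j hj z r

end Unitary

end Literature.MathematicalPhysics.QuantumFieldTheory.Balaban1983to89.B8Eq1112QuotientRec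

end
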